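import Summits.MatrixMultiplication.OmegaCensus.Dicyclic40Law
import Summits.MatrixMultiplication.OmegaCensus.DicyclicLawClassification
import HarnessLib

/-!
# `β(C₂ × G) = 2β(G) = (16|A| − 16)/3` for every dicyclic-type `G = G(A, c₀)` with `A/⟨c₀⟩` cyclic, `|A| ≡ 1 (mod 3)`

ω-census, family (b3).  Framing: lottery ticket; floor = certified bounds/negative ranges.

Companion of `C2C2DicyclicQuotCyclicLaw.lean`.  `C₂ × G = G(ℤ₂ × A, (0, c₀))` (`c2_product_presentation`) has `|A'| = 2|A| ≡ 2 (mod 3)`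
and `c₀' ≠ 0 = 2c₀'`, so the dicyclic law `3V' + 16 ≤ 16|A|` (`tpp_volume_le_law_dicyclicLike`, `|A'| ≥ 14`) holds; `(C₂, 1, 1) ×`
a law triple of `G` (`3V + 8 = 8|A|`, `mod_one_law_attained_of_quot_cyclic`) attains it:
**`c2_dicyclic_law_of_quot_cyclic`: β(C₂ × G) = (16|A| − 16)/3 = 2β(G)** for every such `G` (`|A| ≥ 14`) — the common source of
`c2_quaternion_law` (`m ≡ 2 (mod 3)`) and `c2_semidirect_law` (`n ≡ 2 (mod 3)`).  With the `C₂²` file: along `G, C₂ × G, C₂² × G`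
the values are `β, 2β, 4β − 8` for these groups.
-/

namespace Summit.MatrixMultiplication.OmegaCensus

open Literature.Combinatorics.Additive Finset
open Summit.MatrixMultiplication.MatrixMultiplication.Theorems.JuntaBranch.Planting (tpp_product)

section C2G

variable {A : Type} [AddCommGroup A] [Fintype A] [DecidableEq A] {G : Type} [Group G] [DecidableEq G]
  {ρ τ : A → G} {c₀ : A}

/-- **`β(C₂ × G) = (16|A| − 16)/3` for dicyclic-type `G` over `A` with `A/⟨c₀⟩` cyclic, `|A| ≡ 1 (mod 3)`, `|A| ≥ 14`**:
every TPP triple of `C₂ × G` has `3V + 16 ≤ 16|A|`, with equality attained. [folklore] -/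
theorem c2_dicyclic_law_of_quot_cyclic
    (hρρ : ∀ a b, ρ a * ρ b = ρ (a + b)) (hρτ : ∀ a b, ρ a * τ b = τ (b - a))
    (hτρ : ∀ a b, τ a * ρ b = τ (a + b)) (hττ : ∀ a b, τ a * τ b = ρ (c₀ + b - a)) (hc₀ : c₀ ≠ 0)
    (hρ : Function.Injective ρ) (hτ : Function.Injective τ) (hne : ∀ a b, ρ a ≠ τ b)
    (hsurj : ∀ g, (∃ a, ρ a = g) ∨ (∃ a, τ a = g)) (hmod : Fintype.card A % 3 = 1) (hA : 14 ≤ Fintype.card A)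
    {g : A} (hg : ∀ x : A, x ∈ AddSubgroup.zmultiples g ∨ x + c₀ ∈ AddSubgroup.zmultiples g) :
    (∀ S T U : Finset (Multiplicative (ZMod 2) × G), TripleProductProperty S T U →
        3 * (S.card * T.card * U.card) + 16 ≤ 16 * Fintype.card A) ∧
    ∃ S T U : Finset (Multiplicative (ZMod 2) × G), TripleProductProperty S T U ∧
      3 * (S.card * T.card * U.card) + 16 = 16 * Fintype.card A := by
  refine ⟨fun S T U h => ?_, ?_⟩
  · refine c2_product_presentation hρρ hρτ hτρ hττ hρ hτ hne hsurj
      fun ρ' τ' c₀' hρρ' hρτ' hτρ' hττ' hρ' hτ' hne' hsurj' hc' => ?_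
    subst hc'
    have hc₀' : (((0 : ZMod 2), c₀) : ZMod 2 × A) ≠ 0 := fun h0 => hc₀ (congrArg Prod.snd h0)
    have hcard : Fintype.card (ZMod 2 × A) = 2 * Fintype.card A := by rw [Fintype.card_prod, ZMod.card]
    have key := tpp_volume_le_law_dicyclicLike hρρ' hρτ' hτρ' hττ' hρ' hτ' hne' hsurj'
      (two_c0_eq_zero hρτ' hτρ' hττ' hτ') hc₀' (by rw [hcard]; omega) (by rw [hcard]; omega) h
    rw [hcard] at key
    omega
  · obtain ⟨S, T, U, h, hvol⟩ :=
      mod_one_law_attained_of_quot_cyclic hρρ hρτ hτρ hττ hc₀ hρ hτ hne hsurj hmod hA hg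
    refine ⟨univ ×ˢ S, {1} ×ˢ T, {1} ×ˢ U, tpp_product tpp_univ_one_one h, ?_⟩
    simp only [card_product, card_univ, card_singleton, Fintype.card_multiplicative, ZMod.card]
    have e : 2 * S.card * (1 * T.card) * (1 * U.card) = 2 * (S.card * T.card * U.card) := by ring
    rw [e]
    omega

end C2G

end Summit.MatrixMultiplication.OmegaCensus
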